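import Summits.HubbardSuperconductivity.HubbardSuperconductivity.Theorems.KLProgrammeKLRegimeScaleZeroCovarianceOffSiteSpatialEnvelope
import Summits.HubbardSuperconductivity.HubbardSuperconductivity.Theorems.KLProgrammeKLRegimeScaleZeroCovarianceOffSiteProfileBridge
import Literature.MathematicalPhysics.QuantumLattice.GrassmannLaplacianPairWick
import Literature.MathematicalPhysics.QuantumLattice.HubbardSectorPropagatorGram

/-!
# Route `KLProgramme`, crux K3 — engine-flow child (stmt-HubbardSuperconductivity-20437), stub (C) at `n = 0`, located item #22a «(C)-SCALE0-PT2»,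
# the off-site doors in the assembly's `contr` FORM: `‖contr C X Y‖ = ‖C X Y‖` for the antisymmetric grid covariance, spin-off-diagonal entries vanish

Cell gate-hubbard-kl, seat p1 g20.  The assembly (`…FlowReadScaleZeroAssembly`, rows `hSall/hS0/hSk`) reads the sunset's three covariance factors as
`contr ℂ (hubbardGridSubᵀ·hubbardCovAboveCT L M β μ 0 0 klE0·hubbardGridSub) ((p₁,σ),0) ((p₀,σ),1)` (`contr C X Y = ½(C Y X − C X Y)`,
`GrassmannLaplacianPairWick.contr_apply`).  The pulled-back covariance is antisymmetric (`normalCovariance_transpose`), so `contr C X Y = −C X Y` and the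
norm-form doors (`…OffSiteProfileBridge`, `…OffSiteSpatialEnvelope`) apply verbatim to each factor:

* `gridCov_hubbardCovAboveCT_transpose`, `contr_gridCov_hubbardCovAboveCT_eq_neg`, **`norm_contr_gridCov_hubbardCovAboveCT`**;
* `gridCov_hubbardCovAboveCT_apply_of_spin_ne` — `σ ≠ σ′ ⟹` the `(+,−)` entry (and its `contr`) vanish (spin-diagonal covariance, D7);
* **`enorm_contr_gridCov_offSite_le_tsum_profile`**, **`norm_contr_gridCov_offSite_le_decay`** — the profile door and the spatial-envelope door for
  `‖contr … ((p₁,σ),0) ((p₀,σ),1)‖`, hypothesis-free at the bare frame.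

Proofs only; no definitions; nothing here asserts (C), any stub of 20437, K3 or superconductivity.  References: BGM 2006 §2.1 (2.3)
[cite: BenfattoGiulianiMastropietro2006].
-/

noncomputable section

namespace Summit.HubbardSuperconductivity.HubbardSuperconductivity.Theorems.KLRegimeSplit

set_option linter.dupNamespace false -- summit = problem name (single-conjunct summit), D-0017

open Literature.MathematicalPhysics.QuantumLattice Literature.Probability.LatticeModels Literature.Analysis.FunctionSpaces
open Summit.HubbardSuperconductivity.HubbardSuperconductivity.Theorems.DispersionFlow
open MeasureTheory Set Finset Complex UnitAddTorus Real GrassmannAlgebra Matrix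
open scoped FourierTransform Nat ENNReal NNReal

variable {L M : ℕ} [NeZero L]

/-! ## §1 Antisymmetry and the `contr` form -/

/-- **The pulled-back bare-frame covariance on the grid is antisymmetric.** -/
theorem gridCov_hubbardCovAboveCT_transpose (β μ Λ : ℝ) (K : TrigPolyC4v) (N : ℕ) :
    ((hubbardGridSub L M β N).transpose * hubbardCovAboveCT L M β μ 0 K Λ * hubbardGridSub L M β N).transpose =
      -((hubbardGridSub L M β N).transpose * hubbardCovAboveCT L M β μ 0 K Λ * hubbardGridSub L M β N) := by
  rw [hubbardCovAboveCT_zero_seed_eq_normalCovariance_uvSymbolCT, Matrix.transpose_mul, Matrix.transpose_mul, Matrix.transpose_transpose,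
    normalCovariance_transpose, Matrix.neg_mul, Matrix.mul_neg, Matrix.mul_assoc]

/-- `contr C X Y = −C X Y` for the grid covariance. -/
theorem contr_gridCov_hubbardCovAboveCT_eq_neg (β μ Λ : ℝ) (K : TrigPolyC4v) (N : ℕ) (X Y : GridLeg (GridPoint L N)) :
    contr ℂ ((hubbardGridSub L M β N).transpose * hubbardCovAboveCT L M β μ 0 K Λ * hubbardGridSub L M β N) X Y =
      -((hubbardGridSub L M β N).transpose * hubbardCovAboveCT L M β μ 0 K Λ * hubbardGridSub L M β N) X Y := by
  have h := congrFun (congrFun (gridCov_hubbardCovAboveCT_transpose (L := L) (M := M) β μ Λ K N) X) Y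
  rw [Matrix.transpose_apply, Matrix.neg_apply] at h
  rw [contr_apply, h, Rat.smul_one_eq_cast]
  push_cast
  ring

/-- **`‖contr C X Y‖ = ‖C X Y‖`** for the grid covariance (every frame `K`, every `Λ`). -/
theorem norm_contr_gridCov_hubbardCovAboveCT (β μ Λ : ℝ) (K : TrigPolyC4v) (N : ℕ) (X Y : GridLeg (GridPoint L N)) :
    ‖contr ℂ ((hubbardGridSub L M β N).transpose * hubbardCovAboveCT L M β μ 0 K Λ * hubbardGridSub L M β N) X Y‖ =
      ‖((hubbardGridSub L M β N).transpose * hubbardCovAboveCT L M β μ 0 K Λ * hubbardGridSub L M β N) X Y‖ := by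
  rw [contr_gridCov_hubbardCovAboveCT_eq_neg, norm_neg]

/-- **Spin-off-diagonal `(+,−)` entries vanish**: for `σ ≠ σ′`, `(SᵀC S)((p₁,σ,+),(p₀,σ′,−)) = 0` (D7, spin-diagonal symbol). -/
theorem gridCov_hubbardCovAboveCT_apply_of_spin_ne {β : ℝ} (hβ : 0 < β) (μ Λ : ℝ) (K : TrigPolyC4v) {N : ℕ} (p₁ p₀ : GridPoint L N)
    {σ σ' : Fin 2} (hσ : σ ≠ σ') :
    ((hubbardGridSub L M β N).transpose * hubbardCovAboveCT L M β μ 0 K Λ * hubbardGridSub L M β N) ((p₁, σ), 0) ((p₀, σ'), 1) = 0 := by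
  rw [hubbardCovAboveCT_zero_seed_eq_normalCovariance_uvSymbolCT, hubbardGridSub,
    gridCov_uvSymbolCT_apply_zero_one_eq_sum_freq hβ μ K Λ (fun p : GridPoint L N => p.2) (fun p => gridTime β N p.1) p₁ p₀ σ σ', if_neg hσ]

/-! ## §2 The off-site doors for `‖contr …‖` -/

/-- **Profile door, `contr` form** (bare frame, table-free, either sign of `Δτ`): for grid points with `x₁ ≠ x₀` and any certified profile
`p ≥ ‖(1/2π)𝓕G(·/2π)‖₊` (`G = a¹_·(−z)`): `‖contr(SᵀCS)((p₁,σ,+),(p₀,σ,−))‖₊ ≤ Σ'_m p(−Δτ + mβ) + ofReal(window tail + torus tail)`. -/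
theorem enorm_contr_gridCov_offSite_le_tsum_profile {β : ℝ} (hβ : 0 < β) (hM : 0 < M) (μ : ℝ) {N : ℕ} {p₁ p₀ : GridPoint L N}
    (hx : p₁.2 ≠ p₀.2) (σ : Fin 2) {N' : ℕ} (hN' : 2 * 2 ≤ N') {R : ℕ} (hR : (R : ℤ) + 1 + ∑ j, |((p₁.2 j).val : ℤ) - (p₀.2 j).val| ≤ L)
    {p : ℝ → ℝ≥0∞}
    (hp : ∀ t : ℝ, (‖((1 / (2 * π) : ℝ) : ℂ) * 𝓕 (fun om : ℝ => mFourierCoeff (Torus.descend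
        (fun y : Momentum => uvSymbolFn 1 klE0 (frameLevel μ 0 ((2 * π) • y)) om) (uvSpatialSymbol_isLatticePeriodic 1 klE0 μ 0 om))
        (-(fun j => ((p₁.2 j).val : ℤ) - (p₀.2 j).val))) (t / (2 * π))‖₊ : ℝ≥0∞) ≤ p t) :
    (‖contr ℂ ((hubbardGridSub L M β N).transpose * hubbardCovAboveCT L M β μ 0 0 klE0 * hubbardGridSub L M β N) ((p₁, σ), 0) ((p₀, σ), 1)‖₊ : ℝ≥0∞) ≤
      (∑' m : ℤ, p (-(gridTime β N p₁.1 - gridTime β N p₀.1) + m * β)) +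
        ENNReal.ofReal ((19 / 3) * (4 + |μ| + (0 : TrigPolyC4v).coeffNorm 0) * β / (2 * π ^ 2 * M) +
          (N' ! * klChi2CauchyTab N' * (N' + 1) ! * 4 * (max 1 (4 / klE0)) ^ (N' - 1) * ((2 * π) * 4) ^ N') * (2 / klE0) *
            (1 / (2 * Real.pi) ^ N' * (2 / ((2 * R + 2 : ℕ) : ℝ)) ^ (N' - 2 * 2) * (2 ^ 2 * ∑' k : Site 2, ∏ j, (1 + (k j : ℝ) ^ 2)⁻¹))) := by
  have h := enorm_gridCov_offSite_le_tsum_profile hβ hM μ hx σ hN' hR hp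
  have hn : ‖contr ℂ ((hubbardGridSub L M β N).transpose * hubbardCovAboveCT L M β μ 0 0 klE0 * hubbardGridSub L M β N) ((p₁, σ), 0) ((p₀, σ), 1)‖₊ =
      ‖((hubbardGridSub L M β N).transpose * hubbardCovAboveCT L M β μ 0 0 klE0 * hubbardGridSub L M β N) ((p₁, σ), 0) ((p₀, σ), 1)‖₊ := by
    ext; push_cast; exact norm_contr_gridCov_hubbardCovAboveCT β μ klE0 0 N _ _
  rw [hn]; exact h

/-- **Spatial-envelope door, `contr` form** (bare frame, hypothesis-free): for grid points with `x₁ ≠ x₀`, every `n ≥ 4`: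
`‖contr(SᵀCS)((p₁,σ,+),(p₀,σ,−))‖ ≤ D₁(n)·(2/klE0)·(1+4ⁿS_n)·(1+‖valMinAbs(x₁−x₀)‖_∞)^{-n}`. -/
theorem norm_contr_gridCov_offSite_le_decay {β : ℝ} (hβ : 0 < β) (μ : ℝ) {N : ℕ} {p₁ p₀ : GridPoint L N} (hx : p₁.2 ≠ p₀.2) (σ : Fin 2)
    {n : ℕ} (hn : 2 * 2 ≤ n) :
    ‖contr ℂ ((hubbardGridSub L M β N).transpose * hubbardCovAboveCT L M β μ 0 0 klE0 * hubbardGridSub L M β N) ((p₁, σ), 0) ((p₀, σ), 1)‖ ≤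
      (n ! * klChi2CauchyTab n * (n + 1) ! * 4 * (max 1 (4 / klE0)) ^ (n - 1) * ((2 * π) * 4) ^ n / Real.pi ^ n) * (2 / klE0) *
        ((1 + (4 : ℝ) ^ n * ∑' k : Site 2, ((1 + ‖k‖) ^ n)⁻¹) * ((1 + ‖(fun j => ((p₁.2 - p₀.2) j).valMinAbs : Site 2)‖) ^ n)⁻¹) := by
  rw [norm_contr_gridCov_hubbardCovAboveCT]
  exact norm_gridCov_offSite_le_decay hβ μ hx σ hn

end Summit.HubbardSuperconductivity.HubbardSuperconductivity.Theorems.KLRegimeSplit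

end
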